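/-
Origin: expansion seat `planner-pub-hodgecm-pv07-g3-0`, handover #2 2026-08-18T08:42:39Z (`HOME/pub-hodgecm-pv07-g3/lean/Pv07g3/LocTorusCompact.lean`, md5 872c905f, 434 lines);
landed by the gen-7 packager in gate run 27 as `HodgeCM/PerL34/LocTorusCompact.lean` (import ^import Pv[0-9]+g[0-9]+\.→import HodgeCM.PerL34. ×1).
-/
/-
HodgeCM / PerL34 publication cell — seam S3 set-up, genuine model: COMPACTNESS of the local groups at the places that do
not split, compact-openness of the integral levels, countability of places (pub-hodgecm-pv07-g3, CLAIM #2 = GAPS pv09g4-A8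
residues (d1) + (d0)).
WIP import: `Pv07g3.LocTorusSplit` ↦ `HodgeCM.PerL34.LocTorusSplit` (my HANDOVER #1; it brings pv09-g4's `LocTorusClosed`,
`IdelicTorusModel`, `IdelePlaces`); the other three imports are tree (`HodgeCM.PerL34.ArchimedeanShells` r16:
`InfinitePlace.Completion.isCompact_units_annulus`; `HodgeCM.PerL34.NormOneRelTorusArch` r17:
`NumberField.complexConj_smul_infinitePlace`; `HodgeCM.Automorphic.AdelicUnitaryGroup` r26: the instance
`HodgeCM.Adelic.countable_heightOneSpectrum`).  Complete proofs, no new axioms, nothing cited.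
-/
import Summits.HodgeConjecture.HodgeCM.PerL34.LocTorusSplit_2
import Summits.HodgeConjecture.HodgeCM.PerL34.ArchimedeanShells
import Summits.HodgeConjecture.HodgeCM.PerL34.NormOneRelTorusArch
import Summits.HodgeConjecture.HodgeCM.Automorphic.AdelicUnitaryGroup

/-!
# `locTorus K L v` is compact at non-split places; the levels `(Π_{w∣v} 𝒪_wˣ) ⊓ U_v` are compact open

Per-place items (d1) and (d0) of GAPS pv09g4-A6/A8 for pv09-g4's place-indexed model
`torusEquiv K L : U(1)_{L/K}(𝔸_K) ≃ₜ* Πʳ_v [locTorus K L v, (Π_{w∣v} 𝒪_wˣ) ⊓ locTorus v]` (`IdelicTorusModel`), i.e. the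
topological binders `hBc`, `hBo`, `hBi`, `hcpt` of the S3 end-form (`RallisAdicEnd` / pv13-g3 `IdentificationEnd`) for
`G v := locTorus K L v`, `B v := inH (Π 𝒪ˣ) (locTorus) v`.  Setting as in `LocTorusSplit`: `Aut(L/K) = {1, σ}`
(`h2 : ∀ τ, τ = 1 ∨ τ = σ`, `σ ≠ 1`), `L/K` Galois.  Contents (namespace `HodgeCM.PerL34.IdelicTorusModel`):

* §1 (d0) `Countable (Place K)` (prl1-g4's `countable_heightOneSpectrum` + finiteness of the infinite places);
* §2 every finite place `v` of `K`: `𝒪_uˣ ⊆ L_uˣ` is compact (`isCompact_intUnits_inr`: it is the unit sphere of the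
  proper space `L_u`, lineage `Adic.properSpace`), hence the box `Π_{u∣v} 𝒪_uˣ` (`isCompact_fibSubgroup_inr`) and the
  level **`isCompact_inH_inr`** (END `hBc`; `U_v` is closed, pv09-g4 `isClosed_locTorus`); **`isOpen_inH_pl`** (END `hBo`)
  at every place;
* §3 the archimedean idele coordinates `fci` (`(σ • y)_w = σ_w(y_{σ⁻¹w})`, `(N y)_w = y_w · σ(y_{σw})` in the pair case),
  companion of `LocTorusSplit` §1–§2 (vendored `InfiniteAdeleRing.smul_apply`, `galInfiniteCompletionMap`);
* §4 a finite place `v` under a `σ`-FIXED place `w` ("`v` inert or ramified"): the fibre is `{w}` (`fib_eq_of_fixed`),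
  every `z ∈ U_v` has `Valued.v z_w = 1` (from `z_w · σ_w(z_w) = 1` and `Valued.v ∘ σ_w = Valued.v`, vendored
  `valued_galAdicCompletionMap`), so **`inH_eq_top_of_fixed`** (END `hBi`: the level is everything) and
  **`compactSpace_locTorus_of_fixed : CompactSpace (locTorus K L (inr v))`**;
* §5 an infinite place `v` under a `σ`-fixed place `w` (every infinite place when `L` is CM and `K = L⁺`, §6): the fibre is
  `{w}` (Mathlib `InfinitePlace.exists_smul_eq_of_comap_eq`), `‖z_w‖ = 1` on `U_v` (`‖σ_w y‖ = ‖y‖`, vendored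
  `norm_galInfiniteCompletionMap`), so **`compactSpace_locTorus_inl_of_fixed : CompactSpace (locTorus K L (inl v))`**
  (inside the compact annulus `‖·‖ = 1` of `L_wˣ`, tree `isCompact_units_annulus`); `inH_inl_eq_top` (the level at an
  infinite place is everything, no hypothesis);
* §6 CM specialisations (`K = L⁺`, `σ = c`): `c • w = w` for every infinite place `w` of a CM field (tree
  `NumberField.complexConj_smul_infinitePlace`), so `compactSpace_locTorus_inl_of_isCMField'` at EVERY infinite
  place of `L⁺`; at a finite place under a `c`-fixed `w`: `compactSpace_locTorus_inr_of_isCMField`,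
  `inH_eq_top_inr_of_isCMField`.

What is NOT done here: the dichotomy "every finite `v` of `K` lies under some `w`, and then either `σ • w ≠ w`
(`LocTorusSplit`) or `σ • w = w` (this file)" is left to the consumer as the case split on its `IsSplit v` predicate
(existence of `w` over `v`: Mathlib `Ideal.exists_ideal_liesOver_maximal_of_isIntegral` / vendored surjectivity of
`HeightOneSpectrum.under`).  PerL v5 tex l. 610 ("`U(W_i)(L_{0,v})` is compact unless `v` splits in `L`") and ll. 626–628
("at a non-split finite `v` the group `U(W_i)(L_{0,v}) = L_w^1` is compact and equals `U(1)(𝒪_v)`") describe the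
USE of these facts; nothing of it is cited.
-/

noncomputable section

open Topology Filter Set Sum IsDedekindDomain NumberField
open Literature.NumberTheory Literature.NumberTheory.Automorphic
open scoped RestrictedProduct Classical

namespace HodgeCM.PerL34.IdelicTorusModel

open IdelePlaces RestrictedRegroup RestrictedCutout

variable (K L : Type) [Field K] [Field L] [Algebra K L] [NumberField K] [NumberField L]

/-! ## §1  (d0) Countability of the places of a number field -/

/-- **(d0)** a number field has countably many places (finitely many infinite ones, countably many finite ones —
prl1-g4's `HodgeCM.Adelic.countable_heightOneSpectrum`).  This is the `[Countable ι]` binder of the S3 end-form. -/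
instance countable_place : Countable (Place K) :=
  inferInstanceAs (Countable (InfinitePlace K ⊕ HeightOneSpectrum (𝓞 K)))

/-! ## §2  `𝒪_uˣ` is compact; the levels are compact (finite places) and open (all places) -/

omit [NumberField K] in
/-- The image of `𝒪_uˣ ⊆ L_uˣ` in `L_u` is the unit sphere `‖x‖ = 1`. -/
theorem val_image_intUnits_inr (u : HeightOneSpectrum (𝓞 L)) :
    ((↑) : (u.adicCompletion L)ˣ → u.adicCompletion L) '' (intUnits L (inr u) : Set (u.adicCompletion L)ˣ) =
      Metric.sphere (0 : u.adicCompletion L) 1 := by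
  ext x
  constructor
  · rintro ⟨y, hy, rfl⟩
    rw [mem_sphere_zero_iff_norm]
    exact (mem_intUnits_inr_iff_norm_eq_one u y).1 hy
  · intro hx
    rw [mem_sphere_zero_iff_norm] at hx
    have hx0 : x ≠ 0 := fun h => zero_ne_one (by rw [h, norm_zero] at hx; exact hx)
    exact ⟨Units.mk0 x hx0, (mem_intUnits_inr_iff_norm_eq_one u _).2 hx, rfl⟩

omit [NumberField K] in
/-- **`𝒪_uˣ` is compact** in `L_uˣ` (units topology): it is the unit sphere of the proper metric space `L_u`
(lineage `LocalFactors.DilationModel.Adic.properSpace`, from the compactness of `𝒪_u`), and `L_uˣ → L_u` is an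
embedding (Mathlib `Units.isEmbedding_val₀`). -/
theorem isCompact_intUnits_inr (u : HeightOneSpectrum (𝓞 L)) :
    IsCompact (intUnits L (inr u) : Set (u.adicCompletion L)ˣ) := by
  haveI : ProperSpace (u.adicCompletion L) := LocalFactors.DilationModel.Adic.properSpace L u
  rw [Units.isEmbedding_val₀.isCompact_iff, val_image_intUnits_inr]
  exact isCompact_sphere 0 1

omit [NumberField K] [NumberField L] in
/-- A place of `L` over a finite place of `K` is finite: the points of the fibre of `pl K L` over `inr v`. -/
theorem exists_eq_inr_of_pl_eq_inr {i : Place L} {v : HeightOneSpectrum (𝓞 K)} (hi : pl K L i = inr v) :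
    ∃ u : HeightOneSpectrum (𝓞 L), i = inr u ∧ u.under (𝓞 K) = v := by
  cases i with
  | inl x => exact absurd hi (by rw [pl_inl]; exact Sum.inl_ne_inr)
  | inr u => exact ⟨u, rfl, Sum.inr_injective (by rw [← pl_inr]; exact hi)⟩

omit [NumberField K] [NumberField L] in
/-- A place of `L` over an infinite place of `K` is infinite. -/
theorem exists_eq_inl_of_pl_eq_inl {i : Place L} {v : InfinitePlace K} (hi : pl K L i = inl v) :
    ∃ w : InfinitePlace L, i = inl w ∧ w.comap (algebraMap K L) = v := by
  cases i with
  | inl w => exact ⟨w, rfl, Sum.inl_injective (by rw [← pl_inl]; exact hi)⟩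
  | inr x => exact absurd hi (by rw [pl_inr]; exact Sum.inr_ne_inl)

omit [NumberField K] in
/-- The integral box `Π_{u ∣ v} 𝒪_uˣ` over a finite place is compact. -/
theorem isCompact_fibSubgroup_inr (v : HeightOneSpectrum (𝓞 K)) :
    IsCompact (fibSubgroup (intUnits L) (pl K L) (inr v) : Set (FibGroup K L (inr v))) := by
  have h : (fibSubgroup (intUnits L) (pl K L) (inr v) : Set (FibGroup K L (inr v))) =
      Set.pi Set.univ fun i : Fib (pl K L) (inr v) => (intUnits L i.1 : Set (LocUnits L i.1)) := by
    ext x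
    simp [mem_fibSubgroup_iff]
  rw [h]
  refine isCompact_univ_pi fun i => ?_
  obtain ⟨i, hi⟩ := i
  obtain ⟨u, rfl, -⟩ := exists_eq_inr_of_pl_eq_inr K L hi
  exact isCompact_intUnits_inr L u

omit [NumberField K] in
/-- Over an infinite place the integral box is everything (`intUnits L (inl w) = ⊤`). -/
theorem fibSubgroup_inl_eq_top (v : InfinitePlace K) : fibSubgroup (intUnits L) (pl K L) (inl v) = ⊤ := by
  rw [eq_top_iff]
  intro x _
  rw [mem_fibSubgroup_iff]
  intro i
  obtain ⟨i, hi⟩ := i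
  obtain ⟨w, rfl, -⟩ := exists_eq_inl_of_pl_eq_inl K L hi
  rw [intUnits_inl]
  exact Subgroup.mem_top _

section level

variable [FiniteDimensional K L]

/-- The level `B_k = (Π_{i∣k} 𝒪_iˣ) ⊓ U_k` as a set is the preimage of the box under the inclusion `U_k ⊆ Π L_iˣ`. -/
theorem coe_inH_eq_preimage (k : Place K) :
    (inH (fun k => fibSubgroup (intUnits L) (pl K L) k) (locTorus K L) k : Set (locTorus K L k)) =
      ((↑) : locTorus K L k → FibGroup K L k) ⁻¹' (fibSubgroup (intUnits L) (pl K L) k : Set (FibGroup K L k)) := by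
  ext x
  simp [Subgroup.mem_subgroupOf]

/-- **END binder `hBc`: the level `(Π_{u∣v} 𝒪_uˣ) ⊓ U_v` is compact** at every finite place `v` of `K`
(compact box, `U_v` closed — pv09-g4 `isClosed_locTorus`). -/
theorem isCompact_inH_inr (v : HeightOneSpectrum (𝓞 K)) :
    IsCompact (inH (fun k => fibSubgroup (intUnits L) (pl K L) k) (locTorus K L) (inr v) : Set (locTorus K L (inr v))) := by
  rw [coe_inH_eq_preimage]
  exact (isClosed_locTorus K L (inr v)).isClosedEmbedding_subtypeVal.isCompact_preimage (isCompact_fibSubgroup_inr K L v)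

/-- **END binder `hBo`: the level is open** in `U_k` at every place (pv09-g4 `isOpen_inH` / `isOpen_fibSubgroup`). -/
theorem isOpen_inH_pl (k : Place K) :
    IsOpen (inH (fun k => fibSubgroup (intUnits L) (pl K L) k) (locTorus K L) k : Set (locTorus K L k)) :=
  isOpen_inH _ _ (isOpen_fibSubgroup (intUnits L) (pl K L) (isOpen_intUnits L) (tendsto_pl K L)) k

/-- **END binder `hBi` at the infinite places: the level at an infinite place is all of `U_v`** (no hypothesis). -/
theorem inH_inl_eq_top (v : InfinitePlace K) :
    inH (fun k => fibSubgroup (intUnits L) (pl K L) k) (locTorus K L) (inl v) = ⊤ := by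
  rw [eq_top_iff]
  intro x _
  rw [inH, Subgroup.mem_subgroupOf, fibSubgroup_inl_eq_top]
  exact Subgroup.mem_top _

end level

/-! ## §3  Archimedean idele coordinates of conjugates and of the Galois norm -/

/-- The archimedean local coordinates of an idele as a total dependent family `w ↦ y_w ∈ L_w`. -/
def fci (y : ideleGroup L) (w : InfinitePlace L) : w.Completion :=
  ((ideleEquiv L y (inl w) : (w.Completion)ˣ) : w.Completion)

omit [NumberField K] in
/-- (Ported verbatim from the HodgeCMPerL package; no docstring in the source.) -/
theorem fci_def (y : ideleGroup L) (w : InfinitePlace L) :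
    fci L y w = ((ideleEquiv L y (inl w) : (w.Completion)ˣ) : w.Completion) := rfl

omit [NumberField K] in
/-- (Ported verbatim from the HodgeCMPerL package; no docstring in the source.) -/
@[simp] theorem fci_one (w : InfinitePlace L) : fci L 1 w = 1 := by
  simp [fci_def]

omit [NumberField K] in
/-- **`(σ • y)_w = σ_w (y_{σ⁻¹ w})`** at the infinite places (vendored `InfiniteAdeleRing.smul_apply`, definitional). -/
theorem fci_galSmul (σ : L ≃ₐ[K] L) (y : ideleGroup L) (w : InfinitePlace L) :
    fci L (σ • y) w = galInfiniteCompletionMap σ (smul_inv_smul σ w) (fci L y (σ⁻¹ • w)) := rfl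

omit [NumberField K] in
/-- **`(N y)_w = ∏_σ σ_w (y_{σ⁻¹ w})`** at the infinite places for pv11-g4's Galois norm `N y = ∏_σ σ • y`. -/
theorem fci_ideleGalNorm [FiniteDimensional K L] (y : ideleGroup L) (w : InfinitePlace L) :
    fci L (AdeleRing.ideleGalNorm K L y) w =
      ∏ σ : L ≃ₐ[K] L, galInfiniteCompletionMap σ (smul_inv_smul σ w) (fci L y (σ⁻¹ • w)) := by
  rw [fci_def, AdeleRing.ideleGalNorm_apply, map_prod, ← RestrictedProduct.evalMonoidHom_apply (LocUnits L), map_prod]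
  change ((∏ σ : L ≃ₐ[K] L, (ideleEquiv L (σ • y)) (inl w) : (w.Completion)ˣ) : w.Completion) = _
  rw [Units.coe_prod]
  exact Finset.prod_congr rfl fun σ _ => fci_galSmul K L σ y w

section quadratic

variable {K L}
variable (σ : L ≃ₐ[K] L) (h2 : ∀ τ : L ≃ₐ[K] L, τ = 1 ∨ τ = σ)
include h2

omit [NumberField K] [NumberField L] in
/-- `σ • σ • a = a` for any action of `Aut(L/K) = {1, σ}` (companion of `LocTorusSplit.smul_smul_of_pair`). -/
theorem smul_smul_of_pair' {α : Type*} [MulAction (L ≃ₐ[K] L) α] (a : α) : σ • σ • a = a := by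
  rw [smul_smul, mul_self_of_pair σ h2, one_smul]

omit [NumberField K] [NumberField L] in
/-- `σ⁻¹ • a = σ • a` for any action of `Aut(L/K) = {1, σ}`. -/
theorem inv_smul_of_pair' {α : Type*} [MulAction (L ≃ₐ[K] L) α] (a : α) : σ⁻¹ • a = σ • a := by
  rw [inv_of_pair σ h2]

omit [NumberField K] in
/-- **`(N y)_w = y_w · σ(y_{σw})`** at the infinite places of a quadratic extension. -/
theorem fci_ideleGalNorm_of_pair [FiniteDimensional K L] (hσ : σ ≠ 1) (y : ideleGroup L) (w : InfinitePlace L) :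
    fci L (AdeleRing.ideleGalNorm K L y) w =
      fci L y w * galInfiniteCompletionMap σ (smul_smul_of_pair' σ h2 w) (fci L y (σ • w)) := by
  rw [fci_ideleGalNorm, univ_of_pair σ h2, Finset.prod_pair hσ.symm]
  have h1 : (1 : L ≃ₐ[K] L)⁻¹ • w = w := by rw [inv_one, one_smul]
  congr 1
  · rw [galInfiniteCompletionMap_apply_congr_place K h1 (smul_inv_smul 1 w) (one_smul _ w) (fci L y),
      galInfiniteCompletionMap_one]
  · exact galInfiniteCompletionMap_apply_congr_place K (inv_smul_of_pair' σ h2 w) _ _ (fci L y)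

end quadratic

/-! ## §4  A finite place under a `σ`-fixed place: `U_v` is compact and its level is everything -/

section fixedFinite

variable {K L}
variable (σ : L ≃ₐ[K] L) {w : HeightOneSpectrum (𝓞 L)} {v : HeightOneSpectrum (𝓞 K)}

/-- **The fibre over `v` is `{w}`** when `Aut(L/K) = {1, σ}` and `σ • w = w` (transitivity on the places over `v`,
vendored `HeightOneSpectrum.exists_algEquiv_smul_eq`). -/
theorem fib_eq_of_fixed [IsGalois K L] (hwv : w.under (𝓞 K) = v) (h2 : ∀ τ : L ≃ₐ[K] L, τ = 1 ∨ τ = σ) (hfix : σ • w = w)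
    (i : Fib (pl K L) (inr v)) : i = fibW hwv := by
  rcases fib_cases σ hwv h2 i with h | h
  · exact h
  · rw [h]
    exact Subtype.ext (congrArg inr hfix)

omit [NumberField K] in
/-- In `Γ₀ = ℤᵐ⁰` (any linearly ordered commutative monoid): `a · a = 1 → a = 1`. -/
theorem eq_one_of_mul_self_eq_one {Γ₀ : Type*} [CommMonoid Γ₀] [LinearOrder Γ₀] [IsOrderedMonoid Γ₀] {a : Γ₀}
    (h : a * a = 1) : a = 1 := by
  rcases le_total a 1 with ha | ha
  · refine le_antisymm ha ?_
    have h' := mul_le_mul' (le_refl a) ha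
    rwa [h, mul_one] at h'
  · refine le_antisymm ?_ ha
    have h' := mul_le_mul' (le_refl a) ha
    rwa [h, mul_one] at h'

variable [FiniteDimensional K L]

/-- At a place `w` fixed by `σ`, every `z ∈ U_v` has `Valued.v z_w = 1`: the norm relation reads
`z_w · σ_w(z_w) = 1` and `σ_w` preserves the valuation (vendored `valued_galAdicCompletionMap`). -/
theorem valued_eq_one_of_mem_locTorus_of_fixed [IsGalois K L] (hwv : w.under (𝓞 K) = v)
    (h2 : ∀ τ : L ≃ₐ[K] L, τ = 1 ∨ τ = σ) (hσ : σ ≠ 1) (hfix : σ • w = w) {z : FibGroup K L (inr v)} (hz : z ∈ locTorus K L (inr v)) :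
    Valued.v (((z (fibW hwv) : (w.adicCompletion L)ˣ) : w.adicCompletion L)) = 1 := by
  rw [mem_locTorus_iff_extOne_mem, mem_relNormOneIdeles_iff] at hz
  have h1 : fc L (AdeleRing.ideleGalNorm K L (extOne K L (inr v) z)) w = 1 := by rw [hz, fc_one]
  rw [fc_ideleGalNorm_of_pair σ h2 hσ,
    galAdicCompletionMap_apply_congr_place L hfix (smul_smul_of_pair σ h2 w) hfix (fc L _), fc_extOne_w hwv] at h1
  have h2' := congrArg Valued.v h1
  rw [map_mul, map_one, valued_galAdicCompletionMap] at h2'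
  exact eq_one_of_mul_self_eq_one h2'

/-- At a `σ`-fixed place, `U_v ⊆ Π_{u∣v} 𝒪_uˣ`. -/
theorem mem_fibSubgroup_of_mem_locTorus_of_fixed [IsGalois K L] (hwv : w.under (𝓞 K) = v)
    (h2 : ∀ τ : L ≃ₐ[K] L, τ = 1 ∨ τ = σ) (hσ : σ ≠ 1) (hfix : σ • w = w) {z : FibGroup K L (inr v)} (hz : z ∈ locTorus K L (inr v)) :
    z ∈ fibSubgroup (intUnits L) (pl K L) (inr v) := by
  rw [mem_fibSubgroup_iff]
  intro i
  rw [fib_eq_of_fixed σ hwv h2 hfix i, mem_intUnits_inr_iff_valued_eq_one]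
  exact valued_eq_one_of_mem_locTorus_of_fixed σ hwv h2 hσ hfix hz

/-- **END binder `hBi` (finite non-split places): the level `(Π_{u∣v} 𝒪_uˣ) ⊓ U_v` is all of `U_v`.** -/
theorem inH_eq_top_of_fixed [IsGalois K L] (hwv : w.under (𝓞 K) = v) (h2 : ∀ τ : L ≃ₐ[K] L, τ = 1 ∨ τ = σ)
    (hσ : σ ≠ 1) (hfix : σ • w = w) :
    inH (fun k => fibSubgroup (intUnits L) (pl K L) k) (locTorus K L) (inr v) = ⊤ := by
  rw [eq_top_iff]
  intro g _
  rw [inH, Subgroup.mem_subgroupOf]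
  exact mem_fibSubgroup_of_mem_locTorus_of_fixed σ hwv h2 hσ hfix g.2

/-- At a `σ`-fixed place, `U_v` is a compact subset of `Π_{u∣v} L_uˣ`. -/
theorem isCompact_locTorus_of_fixed [IsGalois K L] (hwv : w.under (𝓞 K) = v)
    (h2 : ∀ τ : L ≃ₐ[K] L, τ = 1 ∨ τ = σ) (hσ : σ ≠ 1) (hfix : σ • w = w) : IsCompact (locTorus K L (inr v) : Set (FibGroup K L (inr v))) :=
  (isCompact_fibSubgroup_inr K L v).of_isClosed_subset (isClosed_locTorus K L (inr v))
    fun _ hz => mem_fibSubgroup_of_mem_locTorus_of_fixed σ hwv h2 hσ hfix hz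

/-- **(d1), finite part: `U_v = locTorus K L v` is compact at a finite place `v` of `K` under a `σ`-fixed place `w`**
("`v` does not split in `L`"); END binder `hcpt v`. -/
theorem compactSpace_locTorus_of_fixed [IsGalois K L] (hwv : w.under (𝓞 K) = v)
    (h2 : ∀ τ : L ≃ₐ[K] L, τ = 1 ∨ τ = σ) (hσ : σ ≠ 1) (hfix : σ • w = w) : CompactSpace (locTorus K L (inr v)) :=
  isCompact_iff_compactSpace.1 (isCompact_locTorus_of_fixed σ hwv h2 hσ hfix)

end fixedFinite

/-! ## §5  An infinite place under a `σ`-fixed place: `U_v` is compact -/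

section fixedInfinite

variable {K L}
variable (σ : L ≃ₐ[K] L) {w : InfinitePlace L} {v : InfinitePlace K}

/-- `w` as a point of the fibre of `pl K L` over the infinite place `v = w|_K`. -/
abbrev fibWi (hwv : w.comap (algebraMap K L) = v) : Fib (pl K L) (inl v) := ⟨inl w, by rw [pl_inl, hwv]⟩

omit [NumberField K] [NumberField L] in
/-- **The fibre over `v` is `{w}`** when `Aut(L/K) = {1, σ}` and `σ • w = w` (Mathlib
`InfinitePlace.exists_smul_eq_of_comap_eq`). -/
theorem fib_eq_of_fixed_inl [IsGalois K L] (hwv : w.comap (algebraMap K L) = v)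
    (h2 : ∀ τ : L ≃ₐ[K] L, τ = 1 ∨ τ = σ) (hfix : σ • w = w) (i : Fib (pl K L) (inl v)) : i = fibWi hwv := by
  obtain ⟨i, hi⟩ := i
  obtain ⟨w', rfl, hw'⟩ := exists_eq_inl_of_pl_eq_inl K L hi
  obtain ⟨τ, hτ⟩ := InfinitePlace.exists_smul_eq_of_comap_eq (k := K) (hwv.trans hw'.symm)
  rcases h2 τ with rfl | rfl
  · rw [one_smul] at hτ
    subst hτ
    rfl
  · rw [hfix] at hτ
    subst hτ
    rfl

variable [FiniteDimensional K L]

omit [FiniteDimensional K L] in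
/-- The `w`-coordinate of the extension by one of a `v`-block (infinite place). -/
theorem fci_extOne_w (hwv : w.comap (algebraMap K L) = v) (z : FibGroup K L (inl v)) :
    fci L (extOne K L (inl v) z) w = ((z (fibWi hwv) : (w.Completion)ˣ) : w.Completion) := by
  change ((proj K L (inl v) (extOne K L (inl v) z) (fibWi hwv) : (w.Completion)ˣ) : w.Completion) = _
  rw [proj_extOne_same]

/-- At an infinite place `w` fixed by `σ`, every `z ∈ U_v` has `‖z_w‖ = 1`: `z_w · σ_w(z_w) = 1` and `σ_w` is an
isometry (vendored `norm_galInfiniteCompletionMap`). -/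
theorem norm_eq_one_of_mem_locTorus_inl_of_fixed [IsGalois K L] (hwv : w.comap (algebraMap K L) = v)
    (h2 : ∀ τ : L ≃ₐ[K] L, τ = 1 ∨ τ = σ) (hσ : σ ≠ 1) (hfix : σ • w = w) {z : FibGroup K L (inl v)} (hz : z ∈ locTorus K L (inl v)) :
    ‖((z (fibWi hwv) : (w.Completion)ˣ) : w.Completion)‖ = 1 := by
  rw [mem_locTorus_iff_extOne_mem, mem_relNormOneIdeles_iff] at hz
  have h1 : fci L (AdeleRing.ideleGalNorm K L (extOne K L (inl v) z)) w = 1 := by rw [hz, fci_one]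
  rw [fci_ideleGalNorm_of_pair σ h2 hσ,
    galInfiniteCompletionMap_apply_congr_place K hfix (smul_smul_of_pair' σ h2 w) hfix (fci L _), fci_extOne_w hwv] at h1
  have h2' := congrArg (‖·‖) h1
  simp only [norm_mul, norm_one, norm_galInfiniteCompletionMap] at h2'
  rcases mul_self_eq_one_iff.1 h2' with h | h
  · exact h
  · exact absurd h (by linarith [norm_nonneg (((z (fibWi hwv) : (w.Completion)ˣ) : w.Completion))])

/-- At a `σ`-fixed infinite place, `U_v` lies in the image of the unit circle/annulus `‖y‖ = 1` of `L_wˣ` under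
`y ↦ (y)` (the fibre is `{w}`). -/
theorem locTorus_inl_subset_image_of_fixed [IsGalois K L] (hwv : w.comap (algebraMap K L) = v)
    (h2 : ∀ τ : L ≃ₐ[K] L, τ = 1 ∨ τ = σ) (hσ : σ ≠ 1) (hfix : σ • w = w) :
    (locTorus K L (inl v) : Set (FibGroup K L (inl v))) ⊆
      (fun y : (w.Completion)ˣ => (Pi.mulSingle (fibWi hwv) y : FibGroup K L (inl v))) ''
        {y : (w.Completion)ˣ | 1 ≤ ‖(y : w.Completion)‖ ∧ ‖(y : w.Completion)‖ ≤ 1} := by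
  intro z hz
  refine ⟨z (fibWi hwv), ?_, ?_⟩
  · have h := norm_eq_one_of_mem_locTorus_inl_of_fixed σ hwv h2 hσ hfix hz
    exact ⟨h.ge, h.le⟩
  · change Pi.mulSingle (fibWi hwv) (z (fibWi hwv)) = z
    funext i
    obtain rfl : i = fibWi hwv := fib_eq_of_fixed_inl σ hwv h2 hfix i
    rw [Pi.mulSingle_eq_same]

/-- At a `σ`-fixed infinite place, `U_v` is a compact subset of `Π_{w'∣v} L_{w'}ˣ` (tree
`InfinitePlace.Completion.isCompact_units_annulus`). -/
theorem isCompact_locTorus_inl_of_fixed [IsGalois K L] (hwv : w.comap (algebraMap K L) = v)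
    (h2 : ∀ τ : L ≃ₐ[K] L, τ = 1 ∨ τ = σ) (hσ : σ ≠ 1) (hfix : σ • w = w) : IsCompact (locTorus K L (inl v) : Set (FibGroup K L (inl v))) :=
  ((InfinitePlace.Completion.isCompact_units_annulus w one_pos 1).image
      (continuous_mulSingle (A := fun j : Fib (pl K L) (inl v) => LocUnits L j.1) (fibWi hwv))).of_isClosed_subset
    (isClosed_locTorus K L (inl v)) (locTorus_inl_subset_image_of_fixed σ hwv h2 hσ hfix)


-- port_pkg: scope closed for this part
end fixedInfinite
end HodgeCM.PerL34.IdelicTorusModel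
end
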